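import Summits.KontsevichZagierPeriods.KontsevichZagierPeriods.Theorems.KzOnePeriodsG2SChart

/-!
# E1 derivations, third kind, part 1: the pole chart `x ≠ x_P` of `E_{A,B}` as an affine curve in `𝔸³`

Cell pub-kz1p (KZ 1-periods), seat 2, gen 21; helper of the rung-1 item, companion of
`KzOnePeriodsE1CMDeriv.lean` (CM unit images as (R4) for the forms of the FIRST and SECOND kind) and of
`KzOnePeriodsG2SChart.lean` (the chart `x ≠ 0` of the sextic model).  Sub-problem `KzOnePeriods` — the
theorem of Huber–Wüstholz [cite: HuberWustholz2022, Thm 13.3 (2) (p. 121)]: every `ℚ̄`-linear relation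
between 1-periods is a consequence of (R1) bilinearity, (R2) forms vanishing on the curve, (R3) exactness,
(R4) functoriality along morphisms of pairs and (R5) homotopy [cite: HuberWustholz2022, §13.1 (A)–(B) (p. 120)].

kz1p's periods of the THIRD kind are `ξ_P(γ) = ∫_γ ξ_P` with `ξ_P = (y + y_P)/(x − x_P) · dx/y` on
`E_{A,B} : y² = x³ + Ax + B`, `P = (x_P, y_P)` (the normalisation line of every E1 certificate; residue
`+2` at `P`, `−2` at `O`, regular at `−P`).  The form `ξ_P` is a rational, not a polynomial, 1-form of the
plane, and the symbols of the tree's formal period space `CurvePeriods` carry POLYNOMIAL forms on smooth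
affine curves.  This part supplies the affine curve on which `ξ_P` is polynomial — the **pole chart**

  `E^w_{A,B}(x₀) = {y² = x³ + Ax + B, (x − x₀)·w = 1} ⊂ 𝔸³`

(the open set `x ≠ x₀` of `E_{A,B}`: the affine curve minus the fibre `{P, −P}` of `x` over `x₀ = x_P`),
exactly as part 9 of the G2S files did for the chart `x ≠ 0` of `C_{a,b,c}`:

* `mem_pointsEW_iff`, `mem_tangentSpaceEW_iff`, and smoothness over `ℚ̄` (`smoothEW`: the Jacobian rows
  `(−f′(x), 2y, 0)`, `(w, 0, x − x₀)` are independent at every point by the Bézout identity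
  `V f′ − U f = 4A³ + 27B²` of the tree (`Weier.eval_bezout`); no point is isolated, by transport of
  `Weier.isSmoothAffineCurve` along the homeomorphism `(x, y) ↦ (x, y, 1/(x − x₀))`);
* the projection `pr = (x, y) : E^w → E` (`projE_mem`; the chain rule `proj_pair` is part 9's) and the
  lift `γ^w = (x, y, 1/(x − x₀))` of every path of `E_{A,B}` avoiding `x = x₀` (`exists_poleChartPath`);
* the unit maps between charts as polynomial maps over `ℚ̄`: `[−1]^w = (x, −y, w)` of `E^w_{A,B}(x₀)`
  and `[d]^w = (−x, d·y, −w)` (`d² = −1`) from `E^w_{A,0}(x₀)` to `E^w_{A,0}(−x₀)` (`negW_mem`, `cmIW_mem`),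
  with the image paths `exists_negWPath`, `exists_cmIWPath`;

Part 2 (`KzOnePeriodsE1XiDeriv.lean`) puts `ξ_P` on this chart, derives kz1p's exact unit-image rules
`[u]^*ξ_{[u]P} = ξ_P` as (R4)+(R1), and supplies the arcs of `E_{A,B}` that realise the corpus paths.
All statements quantify over `C¹` paths with algebraic end points (`CurvePath`).  No definitions (local
notation only), no new axioms; no statement of the programme is cited — the one citation is the
published theorem whose relation span the E1 files instantiate.
-/

noncomputable section

open MvPolynomial Set Complex Filter Topology
open Literature.NumberTheory.Transcendental Literature.NumberTheory.Transcendental.CurvePeriods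
open Summit.KontsevichZagierPeriods.KzOnePeriods.E1Derivation
open Summit.KontsevichZagierPeriods.KzOnePeriods.G2SDerivation

namespace Summit.KontsevichZagierPeriods.KzOnePeriods.XiDerivation

/-- The cubic `x³ + Ax + B ∈ ℂ[x, y, w]`. -/
local notation3 (prettyPrint := false) "fW[" A ", " B "]" =>
  ((X 0 : MvPolynomial (Fin 3) ℂ) ^ 3 + C A * X 0 + C B)

/-- The pole chart `E^w_{A,B}(x₀) = {y² = x³ + Ax + B, (x − x₀)·w = 1} ⊂ 𝔸³` of the open set `x ≠ x₀`. -/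
local notation3 (prettyPrint := false) "EW[" A ", " B ", " x₀ "]" =>
  (⟨3, 2, ![(X 1 : MvPolynomial (Fin 3) ℂ) ^ 2 - fW[A, B], (X 0 - C x₀) * X 2 - 1]⟩ : CurveData)

/-- The projection `pr = (x, y) : E^w_{A,B}(x₀) → E_{A,B}` as a polynomial map. -/
local notation3 (prettyPrint := false) "proj" => (![X 0, X 1] : Fin 2 → MvPolynomial (Fin 3) ℂ)

/-- The unit map `[−1]^w : (x, y, w) ↦ (x, −y, w)` of `E^w_{A,B}(x₀)`. -/
local notation3 (prettyPrint := false) "negW" => (![X 0, -X 1, X 2] : Fin 3 → MvPolynomial (Fin 3) ℂ)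

/-- The unit map `[d]^w : (x, y, w) ↦ (−x, d·y, −w)` (`d² = −1`) from `E^w_{A,0}(x₀)` to `E^w_{A,0}(−x₀)`. -/
local notation3 (prettyPrint := false) "cmIW[" d "]" =>
  (![-X 0, C d * X 1, -X 2] : Fin 3 → MvPolynomial (Fin 3) ℂ)

variable {A B x₀ : ℂ}

/-! ### The pole chart `E^w_{A,B}(x₀) ⊂ 𝔸³` -/

/-- `z ∈ E^w ↔ z₁² = z₀³ + A z₀ + B ∧ (z₀ − x₀) z₂ = 1`. -/
theorem mem_pointsEW_iff (z : Fin 3 → ℂ) :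
    z ∈ EW[A, B, x₀].points ↔ z 1 ^ 2 = z 0 ^ 3 + A * z 0 + B ∧ (z 0 - x₀) * z 2 = 1 := by
  refine (CurveData.mem_points (Z := EW[A, B, x₀]) (z := z)).trans ?_
  rw [show (∀ j : Fin (EW[A, B, x₀]).m, eval z ((EW[A, B, x₀]).F j) = 0) ↔
      ∀ j : Fin 2, eval z ((![(X 1 : MvPolynomial (Fin 3) ℂ) ^ 2 - fW[A, B], (X 0 - C x₀) * X 2 - 1] :
        Fin 2 → MvPolynomial (Fin 3) ℂ) j) = 0 from Iff.rfl]
  simp [Fin.forall_fin_two, sub_eq_zero]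

/-- The gradient of `y² − f`: `(−f′(x), 2y, 0)`. -/
theorem gradientEW_zero (z : Fin 3 → ℂ) :
    EW[A, B, x₀].gradient 0 z = ![-(3 * z 0 ^ 2 + A), 2 * z 1, 0] := by
  funext k
  simp only [CurveData.gradient, Matrix.cons_val_zero]
  fin_cases k
  · simp [pderiv_X_of_ne (show (1 : Fin 3) ≠ 0 by decide)]
  · simp [pderiv_X_of_ne (show (0 : Fin 3) ≠ 1 by decide)]
  · simp [pderiv_X_of_ne (show (0 : Fin 3) ≠ 2 by decide),
      pderiv_X_of_ne (show (1 : Fin 3) ≠ 2 by decide)]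

/-- The gradient of `(x − x₀) w − 1`: `(w, 0, x − x₀)`. -/
theorem gradientEW_one (z : Fin 3 → ℂ) : EW[A, B, x₀].gradient 1 z = ![z 2, 0, z 0 - x₀] := by
  funext k
  simp only [CurveData.gradient, Matrix.cons_val_one]
  fin_cases k
  · simp [pderiv_X_of_ne (show (2 : Fin 3) ≠ 0 by decide)]
  · simp [pderiv_X_of_ne (show (0 : Fin 3) ≠ 1 by decide),
      pderiv_X_of_ne (show (2 : Fin 3) ≠ 1 by decide)]
  · simp [pderiv_X_of_ne (show (0 : Fin 3) ≠ 2 by decide)]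

/-- The tangent line at `z`: `−f′(z₀) v₀ + 2 z₁ v₁ = 0` and `z₂ v₀ + (z₀ − x₀) v₂ = 0`. -/
theorem mem_tangentSpaceEW_iff (z v : Fin 3 → ℂ) :
    v ∈ EW[A, B, x₀].tangentSpace z ↔
      -(3 * z 0 ^ 2 + A) * v 0 + 2 * z 1 * v 1 = 0 ∧ z 2 * v 0 + (z 0 - x₀) * v 2 = 0 := by
  simp only [CurveData.tangentSpace, mem_setOf_eq]
  rw [show (∀ j : Fin (EW[A, B, x₀]).m, ∑ i, (EW[A, B, x₀]).gradient j z i * v i = 0) ↔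
      ∀ j : Fin 2, ∑ i, (EW[A, B, x₀]).gradient j z i * v i = 0 from Iff.rfl, Fin.forall_fin_two]
  rw [show (0 : Fin 2) = (0 : Fin (EW[A, B, x₀]).m) from rfl,
    show (1 : Fin 2) = (1 : Fin (EW[A, B, x₀]).m) from rfl, gradientEW_zero, gradientEW_one]
  simp only [Fin.sum_univ_three, Matrix.cons_val_zero, Matrix.cons_val_one, Matrix.cons_val_two,
    Matrix.head_cons, Matrix.tail_cons, zero_mul, add_zero]

/-- `x³ + Ax + B ∈ ℂ[x, y, w]` has algebraic coefficients when `A, B ∈ ℚ̄`. -/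
theorem hasAlgCoeffs_fW (hA : IsAlgebraic ℚ A) (hB : IsAlgebraic ℚ B) : HasAlgCoeffs fW[A, B] :=
  (((hasAlgCoeffs_X (n := 3) 0).pow 3).add ((hasAlgCoeffs_C hA).mul (hasAlgCoeffs_X 0))).add
    (hasAlgCoeffs_C hB)

/-- The equations of `E^w_{A,B}(x₀)` have algebraic coefficients (`A, B, x₀ ∈ ℚ̄`). -/
theorem hasAlgCoeffs_FEW (hA : IsAlgebraic ℚ A) (hB : IsAlgebraic ℚ B) (hx₀ : IsAlgebraic ℚ x₀) :
    ∀ j, HasAlgCoeffs (EW[A, B, x₀].F j) := by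
  intro j
  fin_cases j
  · simpa using ((hasAlgCoeffs_X (n := 3) 1).pow 2).sub (hasAlgCoeffs_fW hA hB)
  · simpa using (((hasAlgCoeffs_X (n := 3) 0).sub (hasAlgCoeffs_C hx₀)).mul
      (hasAlgCoeffs_X 2)).sub hasAlgCoeffs_one

/-- **Smoothness of the pole chart.**  For algebraic `A, B, x₀` with `4A³ + 27B² ≠ 0`, `E^w_{A,B}(x₀)` is a
smooth affine curve over `ℚ̄`: the Jacobian rows `(−f′(x), 2y, 0)` and `(w, 0, x − x₀)` are independent
at every point (`x ≠ x₀`; `(f′(x), y) ≠ (0, 0)` by the Bézout identity `V f′ − U f = 4A³ + 27B²`), and no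
point is isolated (the homeomorphism `(x, y) ↦ (x, y, 1/(x − x₀))` of `{x ≠ x₀} ⊂ E_{A,B}` onto `E^w`,
`Weier.isSmoothAffineCurve`). -/
theorem smoothEW (hA : IsAlgebraic ℚ A) (hB : IsAlgebraic ℚ B) (hD : Weier.disc A B ≠ 0)
    (hx₀ : IsAlgebraic ℚ x₀) : EW[A, B, x₀].IsSmoothAffineCurve where
  algebraic := hasAlgCoeffs_FEW hA hB hx₀
  rank_eq z hz := by
    obtain ⟨hz1, hz2⟩ := (mem_pointsEW_iff z).1 hz
    have hx : z 0 - x₀ ≠ 0 := left_ne_zero_of_mul_eq_one hz2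
    have hfam : (fun j : Fin (EW[A, B, x₀]).m => EW[A, B, x₀].gradient j z) =
        ![![-(3 * z 0 ^ 2 + A), 2 * z 1, 0], ![z 2, 0, z 0 - x₀]] := by
      funext j
      fin_cases j
      · exact gradientEW_zero z
      · exact gradientEW_one z
    rw [hfam, finrank_span_eq_card]
    · rfl
    rw [LinearIndependent.pair_iff]
    intro s t hst
    have h0 := congrFun hst 0
    have h1 := congrFun hst 1
    have h2 := congrFun hst 2
    simp only [Pi.add_apply, Pi.smul_apply, Matrix.cons_val_zero, Matrix.cons_val_one,
      Matrix.cons_val_two, Matrix.head_cons, Matrix.tail_cons, smul_eq_mul, mul_zero, add_zero,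
      zero_add, Pi.zero_apply] at h0 h1 h2
    have ht : t = 0 := (mul_eq_zero.1 h2).resolve_right hx
    refine ⟨by_contra fun hs => ?_, ht⟩
    rw [ht, zero_mul, add_zero] at h0
    have hf' : 3 * z 0 ^ 2 + A = 0 := by
      have := (mul_eq_zero.1 h0).resolve_left hs
      rwa [neg_eq_zero] at this
    have hy : z 1 = 0 := by
      have := (mul_eq_zero.1 h1).resolve_left hs
      simpa using this
    have hf : z 0 ^ 3 + A * z 0 + B = 0 := by rw [← hz1, hy]; ring
    -- the Bézout identity at the plane point `(z₀, z₁)`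
    have hb := Weier.eval_bezout A B ![z 0, z 1]
    rw [Weier.eval_pderiv_zero_fPoly, Weier.eval_fPoly] at hb
    simp only [Matrix.cons_val_zero] at hb
    rw [hf', hf, mul_zero, mul_zero, sub_zero] at hb
    exact hD hb.symm
  not_isolated z hz := by
    obtain ⟨hz1, hz2⟩ := (mem_pointsEW_iff z).1 hz
    have hx : z 0 - x₀ ≠ 0 := left_ne_zero_of_mul_eq_one hz2
    have hw : (z 0 - x₀)⁻¹ = z 2 := inv_eq_of_mul_eq_one_right hz2
    -- the point of the plane model under `z`
    obtain ⟨p, hp⟩ : ∃ p : Fin 2 → ℂ, p = ![z 0, z 1] := ⟨_, rfl⟩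
    have hp0 : p 0 = z 0 := by rw [hp]; rfl
    have hp1 : p 1 = z 1 := by rw [hp]; rfl
    have hpC : p ∈ (weierCurve A B).points :=
      (Weier.mem_points_iff A B p).2 (by rw [Weier.eval_fPoly, hp0, hp1]; exact hz1)
    have hcl := (Weier.isSmoothAffineCurve A B hA hB hD).not_isolated p hpC
    -- the chart `(x, y) ↦ (x, y, 1/(x − x₀))`
    obtain ⟨h, hh⟩ : ∃ h : (Fin 2 → ℂ) → (Fin 3 → ℂ), h = fun q => ![q 0, q 1, (q 0 - x₀)⁻¹] :=
      ⟨_, rfl⟩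
    have hpx : p 0 - x₀ ≠ 0 := by rw [hp0]; exact hx
    have h0c : ContinuousAt (fun q : Fin 2 → ℂ => q 0) p := (continuous_apply 0).continuousAt
    have h1c : ContinuousAt (fun q : Fin 2 → ℂ => q 1) p := (continuous_apply 1).continuousAt
    have hdc : ContinuousAt (fun q : Fin 2 → ℂ => q 0 - x₀) p := h0c.sub continuousAt_const
    have h2c : ContinuousAt (fun q : Fin 2 → ℂ => (q 0 - x₀)⁻¹) p := hdc.inv₀ hpx
    have hcont : ContinuousAt h p := by
      rw [hh, continuousAt_pi]
      intro k
      fin_cases k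
      · exact h0c
      · exact h1c
      · exact h2c
    have hhp : h p = z := by
      funext k
      fin_cases k
      · simp [hh, hp0]
      · simp [hh, hp1]
      · simp [hh, hp0, hw]
    have htend : Tendsto h (𝓝 p) (𝓝 z) := hhp ▸ hcont.tendsto
    rw [mem_closure_iff_frequently] at hcl ⊢
    have hev : ∀ᶠ q in 𝓝 p, q 0 - x₀ ≠ 0 := hdc.eventually_ne hpx
    have hfr : ∃ᶠ q in 𝓝 p, h q ∈ EW[A, B, x₀].points \ {z} := by
      refine (hcl.and_eventually hev).mono ?_
      rintro q ⟨⟨hqC, hqp⟩, hq0⟩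
      have hqC' := (Weier.mem_points_iff A B q).1 hqC
      rw [Weier.eval_fPoly] at hqC'
      refine ⟨(mem_pointsEW_iff _).2 ⟨?_, ?_⟩, fun hqz => hqp ?_⟩
      · simpa [hh] using hqC'
      · simp [hh, mul_inv_cancel₀ hq0]
      · have e0 := congrFun hqz 0
        have e1 := congrFun hqz 1
        simp only [hh, Matrix.cons_val_zero, Matrix.cons_val_one] at e0 e1
        show q = p
        funext k
        fin_cases k
        · simpa [hp0] using e0
        · simpa [hp1] using e1
    exact htend.frequently hfr

/-! ### The projection `pr : E^w → E` and the lift of paths avoiding `x = x₀` -/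

/-- `pr` maps `E^w_{A,B}(x₀)` into `E_{A,B}`. -/
theorem projE_mem :
    ∀ z ∈ EW[A, B, x₀].points, (fun j => eval z ((proj) j)) ∈ (weierCurve A B).points := by
  intro z hz
  rw [eval_proj, Weier.mem_points_iff, Weier.eval_fPoly]
  simpa using ((mem_pointsEW_iff z).1 hz).1

/-- **The lift to the pole chart.**  A path `γ = (x, y)` on `E_{A,B}` with `x ≠ x₀` on `[0, 1]` (`x₀ ∈ ℚ̄`)
lifts to the path `γ^w = (x, y, 1/(x − x₀))` on `E^w_{A,B}(x₀)` (`C¹`, algebraic end points), with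
`pr ∘ γ^w = γ`. -/
theorem exists_poleChartPath (hx₀ : IsAlgebraic ℚ x₀) {γ : CurvePath (weierCurve A B)}
    (h0 : ∀ t ∈ Icc (0 : ℝ) 1, γ.toFun t 0 ≠ x₀) :
    ∃ γw : CurvePath EW[A, B, x₀],
      ∀ t, γw.toFun t = ![γ.toFun t 0, γ.toFun t 1, (γ.toFun t 0 - x₀)⁻¹] := by
  have hγ := contDiffOn_pi.1 γ.contDiffOn
  have hne : ∀ t ∈ Icc (0 : ℝ) 1, γ.toFun t 0 - x₀ ≠ 0 := fun t ht => sub_ne_zero.2 (h0 t ht)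
  have halg : ∀ {t}, (∀ i, IsAlgebraic ℚ (γ.toFun t i)) →
      ∀ i, IsAlgebraic ℚ ((![γ.toFun t 0, γ.toFun t 1, (γ.toFun t 0 - x₀)⁻¹] : Fin 3 → ℂ) i) := by
    intro t hal i
    fin_cases i
    · simpa using hal 0
    · simpa using hal 1
    · simpa using ((hal 0).sub hx₀).inv
  refine ⟨{ toFun := fun t => ![γ.toFun t 0, γ.toFun t 1, (γ.toFun t 0 - x₀)⁻¹]
            contDiffOn := ?_
            mem_points := ?_
            algebraic_zero := halg γ.algebraic_zero
            algebraic_one := halg γ.algebraic_one }, fun t => rfl⟩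
  · rw [contDiffOn_pi]
    intro k
    fin_cases k
    · exact hγ 0
    · exact hγ 1
    · exact ((hγ 0).sub contDiffOn_const).inv hne
  · intro t ht
    have hC := (Weier.mem_points_iff A B _).1 (γ.mem_points t ht)
    rw [Weier.eval_fPoly] at hC
    refine (mem_pointsEW_iff _).2 ⟨?_, ?_⟩
    · simpa using hC
    · simp [mul_inv_cancel₀ (hne t ht)]

/-! ### The unit maps `[−1]^w` and `[d]^w` between pole charts -/

/-- `[−1]^w` is defined over `ℚ̄`. -/
theorem hasAlgCoeffs_negW : ∀ j, HasAlgCoeffs ((negW) j) := fun j => by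
  fin_cases j
  · simpa using hasAlgCoeffs_X (n := 3) 0
  · simpa using (hasAlgCoeffs_X (n := 3) 1).neg
  · simpa using hasAlgCoeffs_X (n := 3) 2

/-- `[d]^w` is defined over `ℚ̄` (`d² = −1`). -/
theorem hasAlgCoeffs_cmIW {d : ℂ} (hd : d ^ 2 = -1) : ∀ j, HasAlgCoeffs ((cmIW[d]) j) := fun j => by
  fin_cases j
  · simpa using (hasAlgCoeffs_X (n := 3) 0).neg
  · simpa using (hasAlgCoeffs_C (isAlgebraic_of_sq_eq_neg_one hd)).mul (hasAlgCoeffs_X (n := 3) 1)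
  · simpa using (hasAlgCoeffs_X (n := 3) 2).neg

/-- `[−1]^w(z) = (z₀, −z₁, z₂)`. -/
theorem eval_negW (z : Fin 3 → ℂ) : (fun j => eval z ((negW) j)) = ![z 0, -z 1, z 2] := by
  funext j; fin_cases j <;> simp

/-- `[d]^w(z) = (−z₀, d z₁, −z₂)`. -/
theorem eval_cmIW (d : ℂ) (z : Fin 3 → ℂ) :
    (fun j => eval z ((cmIW[d]) j)) = ![-z 0, d * z 1, -z 2] := by
  funext j; fin_cases j <;> simp

/-- `[−1]^w` preserves `E^w_{A,B}(x₀)`. -/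
theorem negW_mem :
    ∀ z ∈ EW[A, B, x₀].points, (fun j => eval z ((negW) j)) ∈ EW[A, B, x₀].points := by
  intro z hz
  obtain ⟨h1, h2⟩ := (mem_pointsEW_iff z).1 hz
  rw [eval_negW, mem_pointsEW_iff]
  simp only [Matrix.cons_val_zero, Matrix.cons_val_one, Matrix.cons_val_two, Matrix.head_cons,
    Matrix.tail_cons]
  exact ⟨by rw [neg_sq]; exact h1, h2⟩

/-- `[d]^w` (`d² = −1`) maps `E^w_{A,0}(x₀)` into `E^w_{A,0}(−x₀)`: `(d y)² = (−x)³ + A(−x)`,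
`(−x − (−x₀))(−w) = (x − x₀) w = 1`. -/
theorem cmIW_mem {d : ℂ} (hd : d ^ 2 = -1) :
    ∀ z ∈ EW[A, 0, x₀].points, (fun j => eval z ((cmIW[d]) j)) ∈ EW[A, 0, -x₀].points := by
  intro z hz
  obtain ⟨h1, h2⟩ := (mem_pointsEW_iff z).1 hz
  rw [eval_cmIW, mem_pointsEW_iff]
  simp only [Matrix.cons_val_zero, Matrix.cons_val_one, Matrix.cons_val_two, Matrix.head_cons,
    Matrix.tail_cons]
  constructor
  · linear_combination (-1 : ℂ) * h1 + z 1 ^ 2 * hd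
  · linear_combination h2

/-- Every path `γ` on `E^w_{A,B}(x₀)` has its image `[−1]^w γ = (x∘γ, −y∘γ, w∘γ)` on `E^w_{A,B}(x₀)`. -/
theorem exists_negWPath (γ : CurvePath EW[A, B, x₀]) :
    ∃ γ' : CurvePath EW[A, B, x₀], ∀ t, γ'.toFun t = ![γ.toFun t 0, -γ.toFun t 1, γ.toFun t 2] :=
  (exists_imagePath (Z := EW[A, B, x₀]) (Z' := EW[A, B, x₀]) negW hasAlgCoeffs_negW negW_mem γ).imp
    fun _ h t => (h t).trans (eval_negW _)

/-- Every path `γ` on `E^w_{A,0}(x₀)` has its image `[d]^w γ = (−x∘γ, d·y∘γ, −w∘γ)` on `E^w_{A,0}(−x₀)`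
(`d² = −1`). -/
theorem exists_cmIWPath {d : ℂ} (hd : d ^ 2 = -1) (γ : CurvePath EW[A, 0, x₀]) :
    ∃ γ' : CurvePath EW[A, 0, -x₀],
      ∀ t, γ'.toFun t = ![-γ.toFun t 0, d * γ.toFun t 1, -γ.toFun t 2] :=
  (exists_imagePath (Z := EW[A, 0, x₀]) (Z' := EW[A, 0, -x₀]) cmIW[d] (hasAlgCoeffs_cmIW hd)
    (cmIW_mem hd) γ).imp fun _ h t => (h t).trans (eval_cmIW d _)

end Summit.KontsevichZagierPeriods.KzOnePeriods.XiDerivation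

end
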